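import Summits.QuantumFields.YangMills.Theorems.LuscherReductionTwistedTraceScalingBOStiffSepEventually
import Summits.QuantumFields.YangMills.Theorems.LuscherReductionTwistedTraceScalingBOStiffSepRecord
import Summits.QuantumFields.YangMills.Theorems.LuscherReductionTwistedTraceScalingBORecordSupport
import Summits.QuantumFields.YangMills.Theorems.FlatTubeReductionStiffSepScheduleK
import Summits.QuantumFields.YangMills.Theorems.FlatTubeReductionRecordSupportK
import HarnessLib

/-!
# The stiff-separation kernel bound `hsep` on `S_out × V_in` at the rate twin's scales (`s = 1/6`, cap constant `K_c`, amplitude window `D·recordDelta1`)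

Support file for the crux `NearFlatRatioLaw` (line `ratepack_v2`, stub `stub_hODpot_A`; successor step (E2) of memo v8 (g19)): lane A's `…BOStiffSepHsep.hsep_record` VERBATIM with
`recordChi_support_K` and `eventually_stiffSep_conditions_K` (the `s = 1/6` schedule) — EXACTLY the hypothesis `hsep` of `…OutPieceK.out_sq_integral_le_of_sep_K` at
`R₀ = r_F/12`, `τ = β^{-1}ℓ`, `δ = D·recordDelta1 L (1/6) β`, `K_sep = e^{2β|E|}e^{−β(r_F/1000)²}`.
★★★ `hsep_record_K`.
-/

set_option autoImplicit false

noncomputable section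

open Filter Topology Real
open scoped BigOperators
open Literature.MathematicalPhysics.QuantumFieldTheory
open Literature.MathematicalPhysics.QuantumLattice

namespace Summit.QuantumFields.YangMills.Theorems.FemtoTransferGap.TwoLattice.ConstTube

open Summit.QuantumFields.YangMills.Theorems.FemtoTransferGap
open Summit.QuantumFields.YangMills.Theorems.FemtoTransferGap.TwoLattice
open Summit.QuantumFields.YangMills.Theorems.FemtoTransferGap.TwoLattice.Avg

variable {L : ℕ} [NeZero L]

set_option maxHeartbeats 800000 in
-- large record expressions.
/-- ★★★ **THE STIFF-SEPARATION KERNEL BOUND ON `S_out × V_in` AT `s = 1/6`, GENERAL CAP CONSTANT, eventually** (see the module docstring). [cite: Luscher1983, §3] -/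
theorem hsep_record_K {D Kc : ℝ} (hD0 : 0 ≤ D) (hKc : 1 ≤ Kc) (hDK : 14 * D / Fintype.card (Site 3 L) ≤ Kc) {M : ℝ} (hM : 0 ≤ M) :
    ∀ᶠ β : ℝ in atTop,
      ∀ U ∈ orthoTubeSet L ∩ {U | (recordChi L (1 / 6) Kc M β) U ≠ 0} ∩ {U | (min (1 / 40) (powScale (1 / 2) β * btLog β)) / 12 < ‖relLinkVec L U‖},
        ‖(gaugeModes L).starProjection (relLinkVec L U)‖ ≤ (powScale 1 β * btLog β) →
        ∀ V ∈ orthoTubeSet L ∩ {V | ‖relLinkVec L V‖ ≤ (min (1 / 40) (powScale (1 / 2) β * btLog β)) / 12 / 2} ∩ {V | ‖(gaugeModes L).starProjection (relLinkVec L V)‖ ≤ (powScale 1 β * btLog β)} ∩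
          {V | ∀ k : Fin 3, ‖su2Quat (slowMean L V (0, k)) - 1‖ ≤ D * recordDelta1 L (1 / 6) β},
          avgKernel β U V ≤ Real.exp (2 * β) ^ Fintype.card (Edge 3 L) * Real.exp (-(β * ((min (1 / 40) (powScale (1 / 2) β * btLog β)) / 1000) ^ 2)) := by
  have hs : (0 : ℝ) < 1 / 6 := by norm_num
  obtain ⟨C, hC, hP⟩ := exists_poincare_vacGrad (L := L)
  filter_upwards [recordChi_support_K (L := L) hs hKc hM, eventually_stiffSep_conditions_K (L := L) hD0 hKc hDK hM hC, eventually_ge_atTop (0 : ℝ)] with β hsupp hcond hβ0 U hU hτU V hV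
  obtain ⟨hrF0, hrF, hτ0, hδ0, hδ1, hδ'0, haU0, hsmall, hϑ1, hg₁, hB⟩ := hcond
  simp only [Set.mem_inter_iff, Set.mem_setOf_eq] at hU hV
  obtain ⟨⟨hUo, hUχ⟩, hUfar⟩ := hU
  obtain ⟨⟨⟨hVo, hVin⟩, hVτ⟩, hVslow⟩ := hV
  obtain ⟨u', x', hx', rfl⟩ := hUo
  obtain ⟨u, x, hx, rfl⟩ := hVo
  rw [relLinkVec_orthoTube L u' hx'] at hUfar hτU
  rw [relLinkVec_orthoTube L u hx] at hVin hVτ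
  rw [slowMean_orthoTube L u hx] at hVslow
  obtain ⟨hlinks, -, -, hslow', -, -⟩ := hsupp _ hUχ
  rw [slowMean_orthoTube L u' hx'] at hslow'
  have e24 : (min (1 / 40) (powScale (1 / 2) β * btLog β)) / 12 / 2 = (min (1 / 40) (powScale (1 / 2) β * btLog β)) / 24 := by ring
  rw [e24] at hVin
  exact avgKernel_le_of_stiffSep_record hβ0 hC hP hrF0 hrF hτ0 hδ0 hδ1 hδ'0 haU0 hsmall hϑ1 hg₁ hB hx hx' hlinks hslow' hVslow hUfar hτU hVin hVτ

end Summit.QuantumFields.YangMills.Theorems.FemtoTransferGap.TwoLattice.ConstTube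

end
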